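import Mathlib
import Summits.Ventures.FusionMHD.Models.RwmFRS1
import Summits.Ventures.FusionMHD.Models.TearingFRS1EqIdealSigmaBoundR5
import HarnessLib

/-!
# F3.r4 instance «RwmFRS1Eq»: the external `(3,1)` kink / RWM of the EXACT FORCE-BALANCED FRS1 screw pinch — MODEL,
# Newcomb's `f`, `g` (with the pressure term) in closed form, the marginal equation in certificate form, boundary form

The force-balanced twin of `RwmFRS1.lean` (model-6 g6; removes caveat W6 of row «F3.r4-FRS1-RWM31»).
MODEL M_RWM,eq (MODELLED column): BY NAME lit-4's exact equilibrium `TearingFRS1.EqSigmaR5.hl5` of #66/#75 (straight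
circular cylinder, `μ₀ = 1`, `B_z ≡ 1`, `B_θ = r/(7(1+r²))` = the printed ν = 1 profile with `q = (7/5)(1+r²)`, and the
FORCE-BALANCE pressure `p = 1/(98(1+r²)²) − 1/392 + 1/19600`, `p′ = −2r/(49(1+r²)³)`; `isRadialPressureBalance5` PROVED
by lit-4: an EXACT ideal-MHD equilibrium), plasma radius `a = 1`, DECLARED `R₀ = 5a` (`k = −1/5`), continued by vacuum and
a thin resistive wall [cite: Freidberg2014, §11.5.6]. CLASS C = the external `(m,n) = (3,1)` mode (`F = (8−7r²)/(35(1+r²))`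
as for the zero-β data: `F`, `F†`, `k₀²`, `f` do not see the pressure).
THIS FILE: `Peq` (the profile by name), the closed forms (`kDotB_eq` … ; Newcomb's `g` (11.90) now WITH the pressure term
`2μ₀k²p′/k₀² = −4r³/(49(1+r²)³(r²+225))`: `g = r·G_eq(r²)/(1225(1+r²)³(r²+225)²)`,
`G_eq(s) = (8−7s)(1+s)G(s) − 100s(s+225) = 2880000 − 2164100s − 2859336s² + 2185527s³ + 23212s⁴ + 49s⁵ > 0` on `[0,1]`),
the marginal equation `P₂ξ″ + P₁ξ′ + P₀ξ = 0` with `P₂ = 25r²(8−7r²)²(1+r²)(r²+225)`,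
`P₁ = 25r(8−7r²)(5400 − 12817r² − 4784r⁴ − 7r⁶)`, `P₀ = −G_eq(r²)` (`rwmEq3p`), the bridge `newcomb_of_isSolOn`, and the
boundary form — IDENTICAL to the zero-β one, `δŴ(L, Λ) = (L − 29)/44296 + Λ/14700` (`RwmFRS1.boundaryForm`; only `L`
changes: float `L_eq = 14.7607` vs `14.3046`). Nothing about a device. [instance data]
-/

noncomputable section

open Set Polynomial Literature.MathematicalPhysics.MHD Literature.Computation.Certificates
  Literature.Computation.Certificates.LinearODE

namespace Summit.Ventures.FusionMHD.Models

namespace RwmFRS1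

namespace Eq

/-! ### The model: the force-balanced FRS1 screw pinch (by name) -/

/-- MODEL M_RWM,eq's plasma equilibrium = lit-4's exact force-balanced twin `TearingFRS1.EqSigmaR5.hl5` seen as a
`ScrewPinch.Profile`. [instance data] -/
def Peq : ScrewPinch.Profile := TearingFRS1.EqSigmaR5.hl5.toProfile

/-- `μ₀ = 1`. [instance data] -/
@[simp] theorem Peq_μ₀ : Peq.μ₀ = 1 := rfl

/-- `B_z ≡ 1`. [instance data] -/
@[simp] theorem Peq_Bz (r : ℝ) : Peq.Bz r = 1 := rfl

/-- `B_θ(r) = r/(7(1+r²))`. [instance data] -/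
theorem Peq_Bθ (r : ℝ) : Peq.Bθ r = r / (7 * (1 + r ^ 2)) := by
  show r * TearingFRS1.EqSigmaR5.u5 r = _
  rw [TearingFRS1.EqSigmaR5.u5]
  ring

/-- `p(r) = 1/(98(1+r²)²) − 1/392 + 1/19600` (force balance). [instance data] -/
theorem Peq_p (r : ℝ) : Peq.p r = 1 / (98 * (1 + r ^ 2) ^ 2) - 1 / 392 + 1 / 19600 := rfl

/-- `p′(r) = −2r/(49(1+r²)³)`. [instance data] -/
theorem hasDerivAt_p (r : ℝ) : HasDerivAt Peq.p (-2 * r / (49 * (1 + r ^ 2) ^ 3)) r := by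
  have e : Peq.p = fun s : ℝ => 1 / (98 * (1 + s ^ 2) ^ 2) - 1 / 392 + 1 / 19600 := funext Peq_p
  rw [e]
  have h1 : (0 : ℝ) < 1 + r ^ 2 := by positivity
  have hc : HasDerivAt (fun s : ℝ => 1 + s ^ 2) (2 * r) r := by simpa using (hasDerivAt_pow 2 r).const_add 1
  have hd : HasDerivAt (fun s : ℝ => 98 * (1 + s ^ 2) ^ 2) (98 * (2 * (1 + r ^ 2) * (2 * r))) r := by
    have := (hc.pow 2).const_mul 98
    exact this.congr_deriv (by push_cast; ring)
  have hq : HasDerivAt (fun s : ℝ => 1 / (98 * (1 + s ^ 2) ^ 2)) (-2 * r / (49 * (1 + r ^ 2) ^ 3)) r := by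
    have := (hasDerivAt_const r (1 : ℝ)).div hd (by positivity)
    refine this.congr_deriv ?_
    field_simp
    ring
  exact (hq.sub_const (1 / 392 : ℝ)).add_const (1 / 19600 : ℝ)

/-- `deriv p = p′`. [instance data] -/
theorem deriv_p (r : ℝ) : deriv Peq.p r = -2 * r / (49 * (1 + r ^ 2) ^ 3) := (hasDerivAt_p r).deriv

/-- The pressure is `C¹`. [instance data] -/
theorem contDiff_p : ContDiff ℝ 1 Peq.p := TearingFRS1.EqSigmaR5.contDiff_p5

/-- MODEL M_RWM,eq is an EXACT equilibrium: radial pressure balance on `(0, 1)` (lit-4, by name). [instance data] -/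
theorem isRadialPressureBalance : Peq.IsRadialPressureBalance 1 := TearingFRS1.EqSigmaR5.isRadialPressureBalance5

/-- The regularity hypotheses of Newcomb's external-mode test for this profile on `(−b, b)`, any `b`. [instance data] -/
theorem profile_regular (b : ℝ) :
    ContDiffOn ℝ 1 Peq.Bθ (Ioo (-b) b) ∧ ContDiffOn ℝ 1 Peq.Bz (Ioo (-b) b) ∧ ContDiffOn ℝ 1 Peq.p (Ioo (-b) b) ∧
      Peq.Bθ 0 = 0 := by
  have hB : ContDiff ℝ 1 Peq.Bθ := by
    rw [show Peq.Bθ = fun r : ℝ => r / (7 * (1 + r ^ 2)) from funext Peq_Bθ]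
    exact ContDiff.div (by fun_prop) (by fun_prop) fun r => by positivity
  refine ⟨hB.contDiffOn, ?_, contDiff_p.contDiffOn, by rw [Peq_Bθ]; simp⟩
  rw [show Peq.Bz = fun _ => (1 : ℝ) from funext Peq_Bz]; exact contDiffOn_const

/-! ### Closed forms for `(m, k) = (3, −1/5)` (fields as in the zero-β data; only `g` sees `p′`) -/

/-- `F = (8 − 7r²)/(35(1+r²))` (`r ≠ 0`). [cite: Freidberg2014, §11.5.1 eq. (11.90)] -/
theorem kDotB_eq {r : ℝ} (hr : r ≠ 0) : Peq.kDotB 3 kk r = (8 - 7 * r ^ 2) / (35 * (1 + r ^ 2)) := by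
  have h1 : (0 : ℝ) < 1 + r ^ 2 := by positivity
  rw [ScrewPinch.Profile.kDotB, Peq_Bθ, Peq_Bz, kk]
  field_simp
  ring

/-- `F† = −(22 + 7r²)/(35(1+r²))` (`r ≠ 0`). [cite: Freidberg2014, §11.5.1 eq. (11.89)] -/
theorem kDotBDagger_eq {r : ℝ} (hr : r ≠ 0) : Peq.kDotBDagger 3 kk r = -(22 + 7 * r ^ 2) / (35 * (1 + r ^ 2)) := by
  have h1 : (0 : ℝ) < 1 + r ^ 2 := by positivity
  rw [ScrewPinch.Profile.kDotBDagger, Peq_Bθ, Peq_Bz, kk]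
  field_simp
  ring

/-- `f = r³(8−7r²)²/(49(1+r²)²(r²+225))` (`r ≠ 0`) — as in the zero-β data. [cite: Freidberg2014, §11.5.1 eq. (11.90)] -/
theorem newcombF_eq {r : ℝ} (hr : r ≠ 0) :
    Peq.newcombF 3 kk r = r ^ 3 * (8 - 7 * r ^ 2) ^ 2 / (49 * (1 + r ^ 2) ^ 2 * (r ^ 2 + 225)) := by
  have h1 : (0 : ℝ) < 1 + r ^ 2 := by positivity
  have h2 : (0 : ℝ) < r ^ 2 + 225 := by positivity
  rw [ScrewPinch.Profile.newcombF, kDotB_eq hr, k0Sq_eq hr]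
  field_simp
  ring

/-- The quintic `G_eq(s) = (8−7s)(1+s)G(s) − 100s(s+225) = 2880000 − 2164100s − 2859336s² + 2185527s³ + 23212s⁴ + 49s⁵`.
[instance data] -/
def Gpoly (s : ℝ) : ℝ := 2880000 - 2164100 * s - 2859336 * s ^ 2 + 2185527 * s ^ 3 + 23212 * s ^ 4 + 49 * s ^ 5

/-- `G_eq(s) = (8−7s)(1+s)·G(s) − 100s(s+225)` with the zero-β cubic `G`. [instance data] -/
theorem Gpoly_eq (s : ℝ) : Eq.Gpoly s = (8 - 7 * s) * (1 + s) * RwmFRS1.Gpoly s - 100 * s * (s + 225) := by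
  unfold Eq.Gpoly RwmFRS1.Gpoly; ring

/-- `G_eq > 0` on `[0, 1]` (`(8−7s)(1+s)G(s) ≥ 1·1·43976 > 22600 ≥ 100s(s+225)` there). [instance data] -/
theorem Gpoly_pos {s : ℝ} (h0 : 0 ≤ s) (h1 : s ≤ 1) : 0 < Eq.Gpoly s := by
  rw [Gpoly_eq]
  have hG := RwmFRS1.Gpoly_pos h0 h1
  have hG' : 43976 ≤ RwmFRS1.Gpoly s := by
    unfold RwmFRS1.Gpoly
    have h2 : s ^ 2 ≤ 1 := by nlinarith
    have h3 : s ^ 3 ≤ 1 := by nlinarith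
    nlinarith
  have h8 : 1 ≤ 8 - 7 * s := by linarith
  have h9 : 1 ≤ 1 + s := by linarith
  have hprod : 43976 ≤ (8 - 7 * s) * (1 + s) * RwmFRS1.Gpoly s := by
    have := mul_le_mul h8 h9 (by norm_num) (by linarith)
    nlinarith
  nlinarith

/-- Newcomb's `g` (11.90) WITH the force-balance pressure: `g = r·G_eq(r²)/(1225(1+r²)³(r²+225)²)` (`r ≠ 0`).
[cite: Freidberg2014, §11.5.1 eq. (11.90)] -/
theorem newcombG_eq {r : ℝ} (hr : r ≠ 0) :
    Peq.newcombG 3 kk r = r * Eq.Gpoly (r ^ 2) / (1225 * (1 + r ^ 2) ^ 3 * (r ^ 2 + 225) ^ 2) := by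
  have h1 : (0 : ℝ) < 1 + r ^ 2 := by positivity
  have h2 : (0 : ℝ) < r ^ 2 + 225 := by positivity
  rw [ScrewPinch.Profile.newcombG, deriv_p, kDotB_eq hr, kDotBDagger_eq hr, k0Sq_eq hr, Eq.Gpoly, kk, Peq_μ₀]
  field_simp
  ring

/-- `F ≠ 0` on `0 < r`, `r² < 8/7`. [instance data] -/
theorem kDotB_ne_zero {r : ℝ} (hr : 0 < r) (h : r ^ 2 < 8 / 7) : Peq.kDotB 3 kk r ≠ 0 := by
  rw [kDotB_eq hr.ne']
  have h1 : (0 : ℝ) < 1 + r ^ 2 := by positivity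
  exact div_ne_zero (by nlinarith) (by positivity)

/-- `f > 0` on `0 < r`, `r² < 8/7`. [instance data] -/
theorem newcombF_pos {r : ℝ} (hr : 0 < r) (h : r ^ 2 < 8 / 7) : 0 < Peq.newcombF 3 kk r := by
  rw [newcombF_eq hr.ne']
  have h3 : (0 : ℝ) < (8 - 7 * r ^ 2) ^ 2 := by nlinarith
  positivity

/-- `g > 0` on the plasma `0 < r ≤ 1` (the destabilising pressure term is dominated). [instance data] -/
theorem newcombG_pos {r : ℝ} (hr : 0 < r) (h : r ≤ 1) : 0 < Peq.newcombG 3 kk r := by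
  rw [newcombG_eq hr.ne']
  have hr2 : r ^ 2 ≤ 1 := by nlinarith
  have hG := Gpoly_pos (sq_nonneg r) hr2
  positivity

/-! ### The marginal equation in certificate form and the bridge -/

/-- The marginal equation of MODEL M_RWM,eq, mode `(3,1)`: `P₂ = 25r²(8−7r²)²(1+r²)(r²+225)`,
`P₁ = 25r(8−7r²)(5400 − 12817r² − 4784r⁴ − 7r⁶)`, `P₀ = −G_eq(r²)`. [instance data] -/
def rwmEq3p : Equation :=
  ⟨[0, 0, 360000, 0, -268400, 0, -355575, 0, 274050, 0, 1225], [0, 1080000, 0, -3508400, 0, 1286175, 0, 835800, 0, 1225],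
    [-2880000, 0, 2164100, 0, 2859336, 0, -2185527, 0, -23212, 0, -49]⟩

/-- `P₂(r) = 25r²(8−7r²)²(1+r²)(r²+225)`. [instance data] -/
theorem eval_P2 (r : ℝ) :
    (toPolyR Eq.rwmEq3p.P2).eval r = 25 * r ^ 2 * (8 - 7 * r ^ 2) ^ 2 * (1 + r ^ 2) * (r ^ 2 + 225) := by
  simp [Eq.rwmEq3p, toPolyR, Finset.sum_range_succ]
  ring

/-- `P₁(r) = 25r(8−7r²)(5400 − 12817r² − 4784r⁴ − 7r⁶)`. [instance data] -/
theorem eval_P1 (r : ℝ) :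
    (toPolyR Eq.rwmEq3p.P1).eval r = 25 * r * (8 - 7 * r ^ 2) * (5400 - 12817 * r ^ 2 - 4784 * r ^ 4 - 7 * r ^ 6) := by
  simp [Eq.rwmEq3p, toPolyR, Finset.sum_range_succ]
  ring

/-- `P₀(r) = −G_eq(r²)`. [instance data] -/
theorem eval_P0 (r : ℝ) : (toPolyR Eq.rwmEq3p.P0).eval r = -Eq.Gpoly (r ^ 2) := by
  rw [Eq.Gpoly]
  simp [Eq.rwmEq3p, toPolyR, Finset.sum_range_succ]
  ring

/-- `P₂ ≠ 0` on `0 < r`, `r² < 8/7`. [instance data] -/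
theorem eval_P2_ne_zero {r : ℝ} (hr : 0 < r) (h : r ^ 2 < 8 / 7) : (toPolyR Eq.rwmEq3p.P2).eval r ≠ 0 := by
  rw [eval_P2]
  have h8 : (0 : ℝ) < (8 - 7 * r ^ 2) ^ 2 := by nlinarith
  positivity

/-- `𝔭 = −P₁/P₂` (the same as for the zero-β data: `f` is unchanged). [instance data] -/
theorem pH_eq {r : ℝ} (hr : 0 < r) (h : r ^ 2 < 8 / 7) :
    Eq.rwmEq3p.pH r = -(5400 - 12817 * r ^ 2 - 4784 * r ^ 4 - 7 * r ^ 6) /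
      (r * (8 - 7 * r ^ 2) * (1 + r ^ 2) * (r ^ 2 + 225)) := by
  have h8 : (8 - 7 * r ^ 2 : ℝ) ≠ 0 := by nlinarith
  have h1 : (0 : ℝ) < 1 + r ^ 2 := by positivity
  have h2 : (0 : ℝ) < r ^ 2 + 225 := by positivity
  have hr0 := hr.ne'
  rw [Equation.pH, eval_P1, eval_P2]
  field_simp

/-- `𝔮 = −P₀/P₂`. [instance data] -/
theorem qH_eq (r : ℝ) :
    Eq.rwmEq3p.qH r = Eq.Gpoly (r ^ 2) / (25 * r ^ 2 * (8 - 7 * r ^ 2) ^ 2 * (1 + r ^ 2) * (r ^ 2 + 225)) := by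
  rw [Equation.qH, eval_P0, eval_P2]
  ring

/-- **BRIDGE**: a certificate solution of `rwmEq3p` on an open `s ⊆ {0 < r, r² < 8/7}` satisfies
`d/dr (f · deriv ξ) = g ξ` for MODEL M_RWM,eq there. [cite: Freidberg2014, §11.5.3 eq. (11.110)] -/
theorem newcomb_of_isSolOn {ξ ξ' : ℝ → ℝ} {s : Set ℝ} (hs : IsOpen s) (hsub : ∀ r ∈ s, 0 < r ∧ r ^ 2 < 8 / 7)
    (hsol : Eq.rwmEq3p.IsSolOn ξ ξ' s) {r : ℝ} (hr : r ∈ s) :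
    HasDerivAt (fun x => Peq.newcombF 3 kk x * deriv ξ x) (Peq.newcombG 3 kk r * ξ r) r := by
  obtain ⟨hr0, hr8⟩ := hsub r hr
  obtain ⟨h1, h2⟩ := hsol r hr
  have hev : ξ' =ᶠ[nhds r] deriv ξ := by
    filter_upwards [hs.mem_nhds hr] with x hx
    exact ((hsol x hx).1.deriv).symm
  have h2' : HasDerivAt (deriv ξ) (Eq.rwmEq3p.pH r * ξ' r + Eq.rwmEq3p.qH r * ξ r) r :=
    h2.congr_of_eventuallyEq hev.symm
  -- `f` is the zero-β `f`: reuse its derivative through the pointwise identity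
  have hfeq : Peq.newcombF 3 kk = P.newcombF 3 kk := by
    funext x
    simp only [ScrewPinch.Profile.newcombF, ScrewPinch.Profile.kDotB, Peq_Bθ, Peq_Bz, P_Bθ, P_Bz]
  have hf := RwmFRS1.hasDerivAt_newcombF (r := r) hr0
  rw [← hfeq] at hf
  have hprod := hf.mul h2'
  refine hprod.congr_deriv ?_
  rw [h1.deriv, newcombF_eq hr0.ne', newcombG_eq hr0.ne', pH_eq hr0 hr8, qH_eq]
  have h8 : (8 - 7 * r ^ 2 : ℝ) ≠ 0 := by nlinarith
  have h8b : (8 : ℝ) - r ^ 2 * 7 ≠ 0 := by nlinarith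
  have h8sq : ((8 : ℝ) - 7 * r ^ 2) ^ 2 ≠ 0 := pow_ne_zero 2 h8
  have h1' : (0 : ℝ) < 1 + r ^ 2 := by positivity
  have h2'' : (0 : ℝ) < r ^ 2 + 225 := by positivity
  have hr0' := hr0.ne'
  field_simp
  ring

/-! ### The boundary form: identical to the zero-β one -/

/-- Edge values: `F_a = 1/70`, `F†_a = −29/70`, `k₀²(a) = 226/25`, `f(a) = 1/44296` — as for the zero-β data. [instance data] -/
theorem edge_values : Peq.kDotB 3 kk 1 = 1 / 70 ∧ Peq.kDotBDagger 3 kk 1 = -29 / 70 ∧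
    ScrewPinch.Profile.k0Sq 3 kk 1 = 226 / 25 ∧ Peq.newcombF 3 kk 1 = 1 / 44296 := by
  refine ⟨?_, ?_, ?_, ?_⟩
  · rw [kDotB_eq one_ne_zero]; norm_num
  · rw [kDotBDagger_eq one_ne_zero]; norm_num
  · rw [k0Sq_eq one_ne_zero]; norm_num
  · rw [newcombF_eq one_ne_zero]; norm_num

/-- lit-4's right-hand side for `Peq` at `a = 1`, `m = 3` IS `RwmFRS1.boundaryForm` (the fields at the edge coincide).
[cite: Freidberg2014, §11.5.3 eq. (11.118)] -/
theorem boundaryForm_mul (ξ₁ : ℝ → ℝ) (Λ : ℝ) :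
    (Peq.kDotB 3 kk 1 ^ 2 / ScrewPinch.Profile.k0Sq 3 kk 1 * (1 * deriv ξ₁ 1 / ξ₁ 1) +
        Peq.kDotB 3 kk 1 * Peq.kDotBDagger 3 kk 1 / ScrewPinch.Profile.k0Sq 3 kk 1 +
        1 ^ 2 * Peq.kDotB 3 kk 1 ^ 2 * Λ / 3) * ξ₁ 1 ^ 2 =
      RwmFRS1.boundaryForm (1 * deriv ξ₁ 1 / ξ₁ 1) Λ * ξ₁ 1 ^ 2 := by
  obtain ⟨e1, e2, e3, -⟩ := edge_values
  rw [RwmFRS1.boundaryForm_eq, e1, e2, e3]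
  ring

end Eq

end RwmFRS1

end Summit.Ventures.FusionMHD.Models

end
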